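import Literature.RingTheory.TightClosure.CartierModuleNilpotence
import Literature.RingTheory.TightClosure.FrobeniusPushforward
import Mathlib.Algebra.Module.Torsion.Basic
import HarnessLib

/-!
# Cartier modules: the examples `(F^e_* R, φ)`, Frobenius powers, Fedder's construction

Topic: `Literature/RingTheory/TightClosure`. Continuation of `CartierModule.lean`, all PROVED:

* `precomp 𝒞 s` — the twisted structure `m ↦ C(s m)` (again `q⁻¹`-linear);
* `image_frobeniusPower_smul_le` — `C(J^[q] N) ⊆ J C(N)` for an ideal `J` (`J^[q]` =
  `frobeniusPower (p^e) J` of `TightClosure.lean`); in particular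
* `isSubmodule_torsionBySet` — the `I`-torsion `M[I] = {m | I m = 0}` is a Cartier submodule
  (Blickle–Böckle Prop. 2.5/2.6: "`I C(m) = C(I^[q] m) ⊆ C(I m) = 0`");
* `ofLinearMap` / `toLinearMap` / `equivLinearMap` — **Cartier structures on `M = R` are the
  `R`-linear maps `F^e_* R → R`** (`F^e_* R` = `FrobeniusPushforward p e R`, the ring `R` with
  `r • x = r^(p^e) x`); Cartier submodules of `(R, φ)` = `φ`-compatible ideals
  (`isSubmodule_ofLinearMap_iff`), and a splitting `φ(1) = 1` has surjective structural map
  (`isSurjective_ofLinearMap`) — the instance "(`F_* R`, Frobenius splitting `φ`)" whose finitely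
  many compatible ideals are the centres of `F`-purity (Blickle–Böckle Prop. 5.4, Schwede 2009);
* `isSubmodule_precomp_of_mul_le` / `fedder` — **Fedder's construction** (the easy direction of
  Fedder's lemma): for an ideal `I` of `S`, a Cartier structure `C` on `S` and `s ∈ (I^[q] : I)`,
  `x ↦ C(s x)` stabilises `I` and so induces a Cartier structure on `S ⧸ I` (as a module over
  itself).

What is NOT here: Fedder's lemma proper — for `S` Gorenstein (e.g. regular) local with `F_*S`
finite free, `Hom_S(F_* S, S) ≅ F_* S` is generated by one map `T` and EVERY Cartier structure on
`S/I` is `T(s ·)` for a unique class `s ∈ (I^[q] : I)/I^[q]` (Fedder 1983, Lemma 1.6 and its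
Corollary, `Hom_S(F_*S/H, S/I) ≅ (I F_*S : H)/I F_*S`); the trace description of `T`; localisation.

## Sources

* [BlickleBockle2011] M. Blickle, G. Böckle, *Cartier modules: finiteness results*, J. reine
  angew. Math. 661 (2011) = arXiv:0909.2531 (arXiv numbering, read): Def. 2.1, Prop. 2.5, 2.6, 5.4.
* [BlickleSchwede2012] M. Blickle, K. Schwede, *`p⁻¹`-linear maps in algebra and geometry*,
  arXiv:1205.4577, §8 (before Prop. 8.? : "`F_*(M[I]) ⊆ (F_* M)[I]` … giving `M[I]` a natural Cartier
  module structure"; "a Frobenius splitting … is nothing but a Cartier module structure on `𝒪_X`").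
* [Fedder1983] R. Fedder, *F-purity and rational singularity*, Trans. AMS 278 (1983) 461–480,
  Lemma 1.6, its Corollary and Prop. 1.7 (held: `paper:doi-10-1090-s0002-9947-1983-0701505-0`, p. 5–6).
-/

noncomputable section

namespace Literature.RingTheory.TightClosure

universe u v

namespace CartierModule

variable {p e : ℕ} {R : Type u} {M : Type v} [CommRing R] [AddCommGroup M] [Module R M]

/-! ## Twisting by an element -/

/-- The **twist** of a Cartier structure by `s ∈ R`: `m ↦ C(s • m)`, again `q⁻¹`-linear
(`C(s r^q m) = r C(s m)`); on `M = R` these are Fedder's maps `sT`. [folklore] -/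
def precomp (𝒞 : CartierModule p e R M) (s : R) : CartierModule p e R M where
  C := 𝒞.C.comp (DistribSMul.toAddMonoidHom M s)
  map_pow_smul' r m := by
    show 𝒞.C (s • (r ^ p ^ e • m)) = r • 𝒞.C (s • m)
    rw [smul_comm, 𝒞.map_pow_smul]

/-- The twisted structural map on elements. [folklore] -/
@[simp]
theorem precomp_C_apply (𝒞 : CartierModule p e R M) (s : R) (m : M) :
    (𝒞.precomp s).C m = 𝒞.C (s • m) :=
  rfl

/-! ## Frobenius powers of ideals and the `I`-torsion submodule -/

/-- **`C(J^[q] • N) ⊆ J • C(N)`** for an ideal `J`, `q = p^e`: `C(∑ rᵢ zᵢ^q nᵢ) = ∑ zᵢ C(rᵢ nᵢ)`.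
[cite: BlickleBockle2011, Prop. 2.6 (proof: "`I C(m) = C(I^[q] m)`")] -/
theorem image_frobeniusPower_smul_le (𝒞 : CartierModule p e R M) (J : Ideal R)
    (N : Submodule R M) : 𝒞.image (frobeniusPower (p ^ e) J • N) ≤ J • 𝒞.image N := by
  intro x hx
  rw [mem_image_iff] at hx
  obtain ⟨m, hm, rfl⟩ := hx
  refine Submodule.smul_induction_on (p := fun m => 𝒞.C m ∈ J • 𝒞.image N) hm ?_ ?_
  · intro a ha n hn
    -- induct over `a ∈ J^[q] = span {z^q : z ∈ J}`, for all `n ∈ N` at once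
    rw [frobeniusPower_def] at ha
    induction ha using Submodule.span_induction generalizing n with
    | mem _ hz =>
      obtain ⟨z, hz, rfl⟩ := hz
      rw [𝒞.map_pow_smul]
      exact Submodule.smul_mem_smul hz (𝒞.apply_mem_image hn)
    | zero => rw [zero_smul, map_zero]; exact Submodule.zero_mem _
    | add a b _ _ ha hb => rw [add_smul, map_add]; exact Submodule.add_mem _ (ha n hn) (hb n hn)
    | smul r a _ ha =>
      rw [smul_eq_mul, mul_comm, mul_smul]
      exact ha (r • n) (N.smul_mem r hn)
  · intro x y hx hy
    rw [map_add]
    exact Submodule.add_mem _ hx hy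

/-- In particular `C` maps `J^[q] M` into `J M`. [cite: BlickleBockle2011, Prop. 2.6 (proof)] -/
theorem apply_mem_smul_top_of_mem (𝒞 : CartierModule p e R M) {J : Ideal R} {m : M}
    (hm : m ∈ frobeniusPower (p ^ e) J • (⊤ : Submodule R M)) : 𝒞.C m ∈ J • (⊤ : Submodule R M) :=
  Submodule.smul_mono le_rfl le_top (𝒞.image_frobeniusPower_smul_le J ⊤ (𝒞.apply_mem_image hm))

/-- **The `I`-torsion `M[I] = {m ∈ M | I m = 0}` is a Cartier submodule** (Blickle–Böckle's
`i^♭ M` for the closed subscheme defined by `I`): if `I m = 0` then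
`I C(m) = C(I^[q] m) ⊆ C(I m) = 0`. [cite: BlickleBockle2011, Prop. 2.6] -/
theorem isSubmodule_torsionBySet [ExpChar R p] (𝒞 : CartierModule p e R M) (I : Ideal R) :
    𝒞.IsSubmodule (Submodule.torsionBySet R M I) := by
  refine isSubmodule_iff.mpr fun m hm => ?_
  rw [Submodule.mem_torsionBySet_iff] at hm ⊢
  rintro ⟨a, ha⟩
  have hq : a ^ p ^ e ∈ (I : Set R) := Ideal.pow_mem_of_mem I ha _ (expChar_pow_pos R p e)
  have h0 := hm ⟨_, hq⟩
  dsimp only at h0 ⊢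
  rw [← 𝒞.map_pow_smul, h0, map_zero]

/-! ## Cartier structures on `R` itself: `R`-linear maps `F^e_* R → R` -/

section Self

variable [ExpChar R p]

open FrobeniusPushforward

/-- An `R`-linear `φ : F^e_* R → R` is a Cartier structure on `M = R`: `C(x) = φ(x)`
(`φ(r^q x) = r φ(x)`). The case `φ(1) = 1` is a Frobenius splitting. [cite: BlickleSchwede2012, §8
("a Frobenius splitting … is nothing but a Cartier module structure on the coherent sheaf `𝒪_X`")] -/
def ofLinearMap (φ : FrobeniusPushforward p e R →ₗ[R] R) : CartierModule p e R R where
  C := φ.toAddMonoidHom.comp (toPush (p := p) (e := e) (R := R)).toAddMonoidHom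
  map_pow_smul' r x := by
    show φ (toPush (r ^ p ^ e • x)) = r • φ (toPush x)
    rw [smul_eq_mul, smul_eq_mul, apply_toPush_pow_mul]

/-- The structural map of `ofLinearMap φ` is `φ` on underlying elements. [folklore] -/
@[simp]
theorem ofLinearMap_C_apply (φ : FrobeniusPushforward p e R →ₗ[R] R) (x : R) :
    (ofLinearMap φ).C x = φ (toPush x) :=
  rfl

/-- Conversely a Cartier structure on `M = R` is an `R`-linear map `F^e_* R → R`.
[cite: BlickleBockle2011, Def. 2.1 ("equivalently, `C` is an `𝒪_X`-linear map `F_* M → M`")] -/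
def toLinearMap (𝒞 : CartierModule p e R R) : FrobeniusPushforward p e R →ₗ[R] R where
  toFun x := 𝒞.C ((toPush (p := p) (e := e) (R := R)).symm x)
  map_add' x y := by rw [map_add, map_add]
  map_smul' r x := by
    obtain ⟨y, rfl⟩ := (toPush (p := p) (e := e) (R := R)).surjective x
    rw [smul_toPush, RingEquiv.symm_apply_apply, RingEquiv.symm_apply_apply, RingHom.id_apply,
      ← smul_eq_mul, 𝒞.map_pow_smul]

/-- `toLinearMap 𝒞` is `C` on underlying elements. [folklore] -/
@[simp]
theorem toLinearMap_apply_toPush (𝒞 : CartierModule p e R R) (x : R) :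
    𝒞.toLinearMap (toPush x) = 𝒞.C x :=
  rfl

/-- **Cartier structures on `R` ≃ `Hom_R(F^e_* R, R)`.** [cite: BlickleBockle2011, Def. 2.1] -/
def equivLinearMap : CartierModule p e R R ≃ (FrobeniusPushforward p e R →ₗ[R] R) where
  toFun := toLinearMap
  invFun := ofLinearMap
  left_inv _ := ext fun _ => rfl
  right_inv _ := LinearMap.ext fun _ => rfl

/-- The Cartier submodules of `(R, φ)` are exactly the **`φ`-compatible ideals** `φ(I) ⊆ I`.
[cite: BlickleSchwede2012, §8.1 (proof of the corollary on Frobenius split `X`: "the Cartier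
submodules of `𝒪_X` are just the ideals which are `φ`-compatible")] -/
theorem isSubmodule_ofLinearMap_iff (φ : FrobeniusPushforward p e R →ₗ[R] R) (I : Ideal R) :
    (ofLinearMap φ).IsSubmodule I ↔ ∀ x ∈ I, φ (toPush x) ∈ I :=
  isSubmodule_iff

/-- A map with `φ(1) = u` a unit (e.g. a **Frobenius splitting**, `φ(1) = 1`) gives a Cartier
structure with SURJECTIVE structural map: `C(r^q) = r φ(1)`. [cite: BlickleSchwede2012, §8.1
(proof of the corollary: "if `φ` is the splitting of Frobenius, note that `φ` is surjective")] -/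
theorem isSurjective_ofLinearMap (φ : FrobeniusPushforward p e R →ₗ[R] R)
    (hφ : IsUnit (φ (toPush 1))) : (ofLinearMap φ).IsSurjective := by
  obtain ⟨u, hu⟩ := hφ
  refine isSurjective_iff.mpr fun r => ⟨(r * ↑u⁻¹) ^ p ^ e • 1, ?_⟩
  rw [(ofLinearMap φ).map_pow_smul, ofLinearMap_C_apply, ← hu, smul_eq_mul, Units.inv_mul_cancel_right]

end Self

/-! ## Fedder's construction -/

/-- **Fedder's construction, step 1.** If `s I ⊆ I^[q]` (i.e. `s ∈ (I^[q] : I)`), then `I` is a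
Cartier submodule of `R` for the twisted structure `x ↦ C(s x)`:
`C(s I) ⊆ C(I^[q] R) ⊆ I C(R) ⊆ I` (the easy implication of Fedder's "the image of `H` under
`sT : F_*S → S` is contained in `I` if and only if `s ∈ (I F_*S : H)`", with `H = I`).
[cite: Fedder1983, Lemma 1.6 (2)] -/
theorem isSubmodule_precomp_of_mul_le (𝒞 : CartierModule p e R R) {I : Ideal R} {s : R}
    (hs : ∀ i ∈ I, s * i ∈ frobeniusPower (p ^ e) I) : (𝒞.precomp s).IsSubmodule I := by
  refine isSubmodule_iff.mpr fun i hi => ?_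
  rw [precomp_C_apply, smul_eq_mul]
  have h1 : s * i ∈ frobeniusPower (p ^ e) I • (⊤ : Submodule R R) := by
    rw [Ideal.smul_eq_mul, Ideal.mul_top]
    exact hs i hi
  have h2 := 𝒞.apply_mem_smul_top_of_mem h1
  rwa [Ideal.smul_eq_mul, Ideal.mul_top] at h2

/-- **Fedder's construction, step 2.** For `s ∈ (I^[q] : I)` the twisted structure `x ↦ C(s x)`
descends to a Cartier structure on the ring `R ⧸ I` (as a module over itself):
`C̄ (r̄^q • x̄) = [C(s r^q x)] = r̄ • [C(s x)]`. For `S` Gorenstein local with `F_*S` finite free and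
`C = T` a generator of `Hom_S(F_*S, S)`, EVERY `R`-linear `F_*R → R`, `R = S/I`, "has the form `sT`
where `s ∈ (I^[p] : I)`" (Fedder; that converse is not proved here).
[cite: Fedder1983, Lemma 1.6 (2), its Corollary, and the proof of Prop. 1.7] -/
def fedder (𝒞 : CartierModule p e R R) (I : Ideal R) (s : R)
    (hs : ∀ i ∈ I, s * i ∈ frobeniusPower (p ^ e) I) : CartierModule p e (R ⧸ I) (R ⧸ I) where
  C := ((𝒞.precomp s).quotient I (𝒞.isSubmodule_precomp_of_mul_le hs)).C
  map_pow_smul' r x := by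
    obtain ⟨r, rfl⟩ := Ideal.Quotient.mk_surjective r
    obtain ⟨x, rfl⟩ := Ideal.Quotient.mk_surjective x
    rw [← map_pow, smul_eq_mul, smul_eq_mul, ← map_mul]
    show Ideal.Quotient.mk I (𝒞.C (s • (r ^ p ^ e * x))) =
      Ideal.Quotient.mk I r * Ideal.Quotient.mk I (𝒞.C (s • x))
    rw [smul_eq_mul, smul_eq_mul, mul_left_comm, ← smul_eq_mul (r ^ p ^ e), 𝒞.map_pow_smul,
      smul_eq_mul, map_mul]

/-- The structural map of `fedder` on classes: `C̄ [x] = [C (s x)]`. [cite: Fedder1983, Lemma 1.6] -/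
@[simp]
theorem fedder_C_mk (𝒞 : CartierModule p e R R) (I : Ideal R) (s : R)
    (hs : ∀ i ∈ I, s * i ∈ frobeniusPower (p ^ e) I) (x : R) :
    (𝒞.fedder I s hs).C (Ideal.Quotient.mk I x) = Ideal.Quotient.mk I (𝒞.C (s * x)) :=
  rfl

end CartierModule

end Literature.RingTheory.TightClosure

end
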